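import Summits.Ventures.Crystal3D.Theorems.StickyWulffConstantNoReconstructionGainFracOrientation
import HarnessLib

/-!
# Decorated-bond orientation certificates (DECO) — the licence and the local shape
# (line `replication-exactness`, inside `stub_noCriminal`; crux `NoReconstructionGain`, stmt-Ventures-19144)

HONEST FRAMING. Part of the venture `Summits/Ventures/Crystal3D` (cell `crystal3d-full`), helper `--supports` the
crux `NoReconstructionGain` (route `route-Ventures-StickyWulffConstant`), lead wulff-p1 g23.  DEFINITIONS of one
certificate class plus its soundness; NO certificate is constructed here and nothing about the crux is proved.

The two pointwise classes of record are closed: height profiles `y(q'→q) = g(h_{q'} − h_q)/2` (no-go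
`WKNoGo.weightedKissing_noGo_ten`, `not_confinedCodeBoundPhys_eight_fifths`) and per-ball Voronoi-flux weights (memo
VFLUX2-g22, LP dual).  Between them and the uncertifiable 2-ring pooling sits the class typed here: an antisymmetric
splitting of every film bond whose value may depend on the bond's DECORATION — the set of balls and substrate sites
touching BOTH ends — and on the positions of both ends.  The decoration of a bond `q'—q` is visible from either end's
1-ring (every common neighbour of `q'` and `q` is a neighbour or a plug of `q`), so the per-ball inequality is a
statement about ONE kissing configuration around `q`: the local shape `DecoBoundLoc`.

* `commonsOf A a b` — the members of `A` at distance exactly `1` from both `a` and `b` (symmetric in `a, b`);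
* `DecoAdmissible Y` — antisymmetry `Y a b K + Y b a K = 1` of a decorated rule `Y : E → E → Set E → ℝ`
  (value of the bond `a → b` with decoration `K`; NO sign or range condition is needed);
* `DecoBound ν s Y` — the per-film shape: at every ball `q` of every film on `H(ν,s)`,
  `Σ_{q'∼q} Y q' q (commonsOf (Q ∪ H) q' q) + plug q ≤ 6`;
* `not_isCriminal_of_decoBound` — **the licence**: an admissible rule with the per-film shape leaves no criminal on
  `H(ν,s)` (through `not_isCriminal_of_fracOrientation`, p713071);
* `IsLegalDatum ν s x₀ N`, `DecoBoundLoc ν s Y` — the LOCAL shape: the same inequality for every legal decorated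
  kissing datum (`x₀` and the finite set `N` of its film neighbours legal, `N` on the unit sphere of `x₀`, pairwise
  `≥ 1`; decorations computed inside `N ∪ plugSet x₀`) — a statement about `≤ 12` unit vectors and the registry of
  `x₀`, i.e. of certifiable size;
* `decoBound_of_loc`, `not_isCriminal_of_decoBoundLoc` — local shape ⟹ per-film shape ⟹ no criminal (the
  neighbourhood of a film ball is a legal datum, and its decorations inside the film are its decorations inside the
  datum).

Duality (memo DECO-g23 §2, not formalised): on a finite universe of data a rule exists iff no PAIR-BALANCED nonnegative
mixture of data has `Σ (plug + deg/2 − 6) > 0`; mixtures of plug-free (floating) data never qualify — the mechanism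
that kills height profiles is absent here.  WHAT THIS IS NOT: `DecoBoundLoc ν s Y` is proved for NO `Y`; rung F-C1 and
the crux are not moved.
-/

noncomputable section

namespace Summit.Ventures.Crystal3D.Theorems

open Summit.Ventures.Crystal3D Finset
open scoped InnerProductSpace

/-- The DECORATION of the bond `a—b` inside the point set `A`: members of `A` at distance exactly `1` from both. -/
def commonsOf (A : Set (EuclideanSpace ℝ (Fin 3))) (a b : EuclideanSpace ℝ (Fin 3)) :
    Set (EuclideanSpace ℝ (Fin 3)) :=
  {k | k ∈ A ∧ dist k a = 1 ∧ dist k b = 1}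

/-- The decoration is symmetric in the two ends. -/
theorem commonsOf_comm (A : Set (EuclideanSpace ℝ (Fin 3))) (a b : EuclideanSpace ℝ (Fin 3)) :
    commonsOf A a b = commonsOf A b a := by
  ext k; simp only [commonsOf, Set.mem_setOf_eq]; tauto

/-- **Admissible decorated rule**: `Y a b K` is the share of the bond `a → b` with decoration `K` charged to `b`;
antisymmetry `Y a b K + Y b a K = 1`.  No sign condition. -/
def DecoAdmissible (Y : EuclideanSpace ℝ (Fin 3) → EuclideanSpace ℝ (Fin 3) → Set (EuclideanSpace ℝ (Fin 3)) → ℝ) :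
    Prop :=
  ∀ a b K, Y a b K + Y b a K = 1

/-- **Per-film DECO shape** on the half-crystal `H(ν,s)`: at every ball `q` of every film `Q`, the decorated in-shares
of its film bonds plus its plugs total at most `6` (decorations computed in `Q ∪ H(ν,s)`). -/
def DecoBound (ν : EuclideanSpace ℝ (Fin 3)) (s : ℝ)
    (Y : EuclideanSpace ℝ (Fin 3) → EuclideanSpace ℝ (Fin 3) → Set (EuclideanSpace ℝ (Fin 3)) → ℝ) : Prop :=
  ∀ Q : Finset (EuclideanSpace ℝ (Fin 3)), IsFilmOn ν s Q → ∀ q ∈ Q,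
    ∑ q' ∈ Q.filter (fun q' => dist q q' = 1), Y q' q (commonsOf (↑Q ∪ halfCrystal ν s) q' q)
      + ((plugSet ν s q).ncard : ℝ) ≤ 6

/-- **The licence.** An admissible decorated rule satisfying the per-film shape on `H(ν,s)` leaves no criminal there. -/
theorem not_isCriminal_of_decoBound {ν : EuclideanSpace ℝ (Fin 3)} {s : ℝ}
    {Y : EuclideanSpace ℝ (Fin 3) → EuclideanSpace ℝ (Fin 3) → Set (EuclideanSpace ℝ (Fin 3)) → ℝ}
    (hY : DecoAdmissible Y) (hB : DecoBound ν s Y) (Q : Finset (EuclideanSpace ℝ (Fin 3))) :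
    ¬ IsCriminal ν s Q := by
  intro hc
  have hfilm : IsFilmOn ν s Q := hc.1
  refine not_isCriminal_of_fracOrientation
    (fun a b => Y a b (commonsOf (↑Q ∪ halfCrystal ν s) a b)) ?_ ?_ hc
  · intro q _ q' _ _
    show Y q q' (commonsOf _ q q') + Y q' q (commonsOf _ q' q) = 1
    rw [commonsOf_comm _ q' q]; exact hY q q' _
  · intro q hq; exact hB Q hfilm q hq

/-! ## The local shape: one decorated kissing configuration at a time -/

/-- A **legal decorated kissing datum** on `H(ν,s)`: a centre `x₀` at distance `≥ 1` from every site, and a finite set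
`N` of film neighbours — each on the unit sphere of `x₀`, at distance `≥ 1` from every site, pairwise at distance `≥ 1`. -/
def IsLegalDatum (ν : EuclideanSpace ℝ (Fin 3)) (s : ℝ) (x₀ : EuclideanSpace ℝ (Fin 3))
    (N : Finset (EuclideanSpace ℝ (Fin 3))) : Prop :=
  (∀ p ∈ halfCrystal ν s, 1 ≤ dist x₀ p) ∧
  (∀ x ∈ N, dist x₀ x = 1 ∧ ∀ p ∈ halfCrystal ν s, 1 ≤ dist x p) ∧
  (∀ x ∈ N, ∀ x' ∈ N, x ≠ x' → 1 ≤ dist x x')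

/-- **Local DECO shape**: for every legal decorated kissing datum `(x₀, N)`, the decorated in-shares of the bonds
`x → x₀` (`x ∈ N`; decoration = members of `N ∪ plugSet x₀` touching both ends) plus the plugs of `x₀` total `≤ 6`.
A statement about at most twelve unit vectors and the registry of `x₀` — the certifiable form. -/
def DecoBoundLoc (ν : EuclideanSpace ℝ (Fin 3)) (s : ℝ)
    (Y : EuclideanSpace ℝ (Fin 3) → EuclideanSpace ℝ (Fin 3) → Set (EuclideanSpace ℝ (Fin 3)) → ℝ) : Prop :=
  ∀ (x₀ : EuclideanSpace ℝ (Fin 3)) (N : Finset (EuclideanSpace ℝ (Fin 3))), IsLegalDatum ν s x₀ N →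
    ∑ x ∈ N, Y x x₀ (commonsOf (↑N ∪ plugSet ν s x₀) x x₀) + ((plugSet ν s x₀).ncard : ℝ) ≤ 6

/-- Inside a film, the decoration of a bond `q'—q` computed in `Q ∪ H` equals the one computed in the datum of `q`
(its film neighbours and its plugs): a common neighbour of `q'` and `q` is a neighbour or a plug of `q`. -/
theorem commonsOf_film_eq {ν : EuclideanSpace ℝ (Fin 3)} {s : ℝ} (Q : Finset (EuclideanSpace ℝ (Fin 3)))
    (q q' : EuclideanSpace ℝ (Fin 3)) :
    commonsOf (↑Q ∪ halfCrystal ν s) q' q =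
      commonsOf (↑(Q.filter fun x => dist q x = 1) ∪ plugSet ν s q) q' q := by
  ext k
  simp only [commonsOf, Set.mem_setOf_eq, Set.mem_union, Finset.mem_coe, Finset.mem_filter, plugSet]
  constructor
  · rintro ⟨hk, h1, h2⟩
    refine ⟨?_, h1, h2⟩
    rcases hk with hk | hk
    · exact Or.inl ⟨hk, by rw [dist_comm]; exact h2⟩
    · exact Or.inr ⟨hk, by rw [dist_comm]; exact h2⟩
  · rintro ⟨hk, h1, h2⟩
    refine ⟨?_, h1, h2⟩
    rcases hk with hk | hk
    · exact Or.inl hk.1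
    · exact Or.inr hk.1

/-- **Local ⟹ per-film.** The neighbourhood of a ball of a film is a legal datum and carries the same decorations. -/
theorem decoBound_of_loc {ν : EuclideanSpace ℝ (Fin 3)} {s : ℝ}
    {Y : EuclideanSpace ℝ (Fin 3) → EuclideanSpace ℝ (Fin 3) → Set (EuclideanSpace ℝ (Fin 3)) → ℝ}
    (hL : DecoBoundLoc ν s Y) : DecoBound ν s Y := by
  intro Q hQ q hq
  set N := Q.filter fun x => dist q x = 1 with hN
  have hdat : IsLegalDatum ν s q N := by
    refine ⟨fun p hp => hQ.2 q hq p hp, fun x hx => ?_, fun x hx x' hx' hne => ?_⟩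
    · rw [hN, Finset.mem_filter] at hx
      exact ⟨hx.2, fun p hp => hQ.2 x hx.1 p hp⟩
    · rw [hN, Finset.mem_filter] at hx hx'
      exact hQ.1 x hx.1 x' hx'.1 hne
  have key := hL q N hdat
  have hsum : ∑ x ∈ N, Y x q (commonsOf (↑N ∪ plugSet ν s q) x q) =
      ∑ q' ∈ Q.filter (fun q' => dist q q' = 1), Y q' q (commonsOf (↑Q ∪ halfCrystal ν s) q' q) := by
    refine Finset.sum_congr rfl fun x _ => ?_
    rw [commonsOf_film_eq Q q x]
  rw [hsum] at key
  exact key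

/-- **Local shape ⟹ no criminal** on `H(ν,s)`. -/
theorem not_isCriminal_of_decoBoundLoc {ν : EuclideanSpace ℝ (Fin 3)} {s : ℝ}
    {Y : EuclideanSpace ℝ (Fin 3) → EuclideanSpace ℝ (Fin 3) → Set (EuclideanSpace ℝ (Fin 3)) → ℝ}
    (hY : DecoAdmissible Y) (hL : DecoBoundLoc ν s Y) (Q : Finset (EuclideanSpace ℝ (Fin 3))) :
    ¬ IsCriminal ν s Q :=
  not_isCriminal_of_decoBound hY (decoBound_of_loc hL) Q

end Summit.Ventures.Crystal3D.Theorems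

end
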